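import Literature.MathematicalPhysics.QuantumFieldTheory.Balaban1983to89.BlockAveragingFederbush
import Literature.MathematicalPhysics.QuantumFieldTheory.Balaban1983to89.B7TransferAnalyticMean

/-!
# FEDERBUSH'S GROUP AVERAGE (0.10) of [Balaban1987RG1] NEAR THE IDENTITY TUPLE — the quantitative (0.8)-forms
# consumed by the [B7] transfer ((0.8′)=(U4), (47′), LIPSCHITZ, and the (U5) use-form) WITH EXPLICIT NUMERICAL
# CONSTANTS for print's own proposal `M`, plus (0.5), (0.6), (0.7), (0.9) and the identification with `federbushU/SU`

T. Bałaban, *Renormalization group approach to lattice gauge field theories. I*, Comm. Math. Phys. **109** (1987)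
249–301 (`Balaban1987RG1`, "B12"), §0 p. 253 (render read as image; loci certified in the audit cells C-pv26g2-4,
C-pv26g3-2, C-ref5-78, C-pv26g6-1 of the programme that commissioned this file):

«Let us write a definition which is equivalent to the one given by Federbush in [35]. The average of the set {U_j} is
the element U ∈ Gᶜ such that U_j are in a small neighborhood of U, and it satisfies the equation
Σ_{j=1}^{n} (1/i) log U_j U⁻¹ = 0. (0.10)», and, among «the properties listed above» (same page):
«M({U_j⁻¹}) = M({U_j})⁻¹; (0.5) M({uU_jv}) = uM({U_j})v; (0.6) M(π{U_j}) = M({U_j}) for an arbitrary permutation π of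
the set {U_j}; (0.7)», «for a set {U_j} of elements close to the identity of the group, i.e. U_j = exp iA_j with A_j in
a small neighborhood of 0 in gᶜ, the average is close to the identity also, and (1/i) log M({exp iA_j}) =
(1/n) Σ_{j=1}^{n} A_j + (higher order terms); (0.8) if U_j ∈ G, then M({U_j}) ∈ G also. (0.9)».  Reference [35 (II)]
of B12 is an unpublished preprint; NOTHING from it is used or cited here.

## Position of this file (two companions, both READ-ONLY imports)

* `BlockAveragingFederbush` CONSTRUCTS print's proposal (0.10): in any complete normed `ℂ`-algebra `𝔄`, for a tuple
  `U : ι → 𝔄` with all `‖U_j − 1‖ ≤ 1/100`, `fedSol U` is THE solution `X` of `Σ_j log (U_j X) = 0` with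
  `‖X − 1‖ ≤ 3/100` (unique in `‖X − 1‖ ≤ 2/25`, Lipschitz in `U`, with `‖log X + |ι|⁻¹ Σ_j log U_j‖ ≤ 35 δ²`), and
  packages it — in relative coordinates `U_j U₀*` — as the `GroupAverage` inhabitants `federbushU`, `federbushSU`.
* `B7TransferAnalyticMean` types the COMPLEMENTARY analytic half of print's axioms as a hypothesis structure
  `IsAnalyticMean M r K` («analytic» on the polydisc `‖U − 1‖ < r` + «close to the identity» `‖M U − 1‖ ≤ K`) and
  DERIVES from it, with constants in `(r, K)`, the quantitative forms of (0.8) that the transfer of [B7] (Bałaban,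
  *Averaging operations for lattice gauge theories*, CMP **98** (1985), `Balaban1985Averaging`) to an abstract average
  consumes — per its own header, no instance of `IsAnalyticMean` is constructed there, "in particular none for the
  printed average (0.10)".

THIS FILE supplies those consumed forms FOR PRINT'S OWN PROPOSAL (0.10), i.e. for

  `fedMean U := (fedSol U)⁻¹`  — THE `M` with `Σ_j log (U_j M⁻¹) = 0` (`sum_mlog_mul_inverse_fedMean`),

in exactly the shapes of `B7TransferAnalyticMean` §3–§4 (tuples `ι → 𝔄` with the sup norm, `meanCLM ι 𝔄` the
arithmetic mean, `NormedSpace.exp`, `MatrixLog.mlog`), with NUMBERS in place of the `(r, K)`-expressions and WITHOUT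
the analyticity hypothesis — by the real-variable MEAN-VALUE-DEFECT method of `BlockAveragingFederbush` §1
(`‖log A − log B − (A − B)‖ ≤ ρ/(1 − ρ) · ‖A − B‖` on `‖· − 1‖ ≤ ρ`):

| consumed form | `IsAnalyticMean M r K` gives | for `fedMean` this file proves |
|---|---|---|
| Lipschitz near `1` | `‖M(U+V) − M U‖ ≤ 8K/r·‖V‖` (`‖U−1‖ ≤ r/2`, `‖V‖ ≤ r/8`) | `≤ 11/5·‖V‖` (`‖U−1‖, ‖V‖ ≤ 1/200`): `norm_fedMean_add_sub_fedMean_le`; two-point form on `1/100`: `norm_fedMean_sub_fedMean_le` |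
| (0.8′)=(U4) | `‖log M(e^X) − mean X‖ ≤ 64K‖X‖²/r²` (`‖X‖ ≤ r/8`) | `≤ 140‖X‖²` (`‖X‖ ≤ 1/200`): `norm_mlog_fedMean_exp_sub_mean_le` |
| (47′) | `‖log M(U) − mean(log U_j)‖ ≤ 256K‖U−1‖²/r²` (`‖U−1‖ ≤ r/16`) | `≤ 35‖U−1‖²` (`‖U−1‖ ≤ 1/100`): `norm_mlog_fedMean_sub_mean_mlog_le` |
| (U5) use-form | `‖log M(e^{a}Z) − log M(Z) − mean a‖ ≤ (2+192K/r²)‖a‖‖Z−1‖ + (1+192K/r²)‖a‖²` | `≤ 60‖a‖‖Z−1‖ + 100‖a‖²` (`‖Z−1‖, ‖a‖ ≤ 1/400`): `norm_mlog_fedMean_expMul_sub_mlog_sub_mean_le` |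

so the `M`-dependence ledger of the programme's gap row G-B7t-1 ((m1)–(m4), see `B7TransferAnalyticMean`'s header)
reads, FOR (0.10): `C_M = 140` on `max_j ‖X_j‖ ≤ 1/200`, `L_M = 11/5` on `max_j ‖U_j − 1‖ ≤ 1/100`, use-form
constants `(60, 100)` on `‖Z − 1‖, max_j ‖a_j‖ ≤ 1/400`; the small-field radius is the number `1/100` (resp. `1/200`,
`1/400`).  All constants and radii are the FILE's (print: «(higher order terms)», «sufficiently small diameters»).

Further (§1b, §6): (0.5) `fedMean_inverse` (`M(U⁻¹) = M(U)⁻¹`: the solution of (0.10) for the inverse family is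
`M(U)` itself, `log (U_j⁻¹ X⁻¹) = −X log(U_j X) X⁻¹`), (0.6) `fedMean_conj` for conjugation by a pair `v, w = v⁻¹`
preserving `‖· − 1‖` (print's general two-sided `M(uUv) = uM(U)v` is the matrix-level `fedM_conj` of the construction
file, in relative coordinates), (0.7) `fedMean_comp_equiv`, constants `fedMean_const`, (0.9) `fedMean_mem_unitaryGroup`,
and the IDENTIFICATION `fedM_eq_fedMean` / `federbushU_M_eq_fedMean` / `federbushSU_M_eq_fedMean`: on a unitary family
near the identity matrix the group average of `BlockAveragingFederbush` (base point `U₀`) IS `fedMean U` (both solve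
(0.10) in the uniqueness polydisc) — ONE object serves the `GroupAverage` interface (module `Setup`) and the
quantitative (0.8)-forms above.  Since `fedMean` is defined on ALL tuples of `𝔄` near the identity tuple (units, not
only unitaries), §1–§5 are the `Gᶜ`-valued average of print on a neighbourhood of the identity tuple, for
`Gᶜ ⊂ 𝔄 = M_N(ℂ)` or any complete normed `ℂ`-algebra.

## What is NOT encoded

* ANALYTICITY / differentiability of `U ↦ fedMean U` is NOT proved in THIS file (it follows from the analytic
  implicit function theorem — Mathlib's `ContDiffAt.implicitFunction` in the class `C^ω` over `ℂ` — applied to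
  `(U, X) ↦ fed U X`, whose partial derivative in `X` is within `1/6` of the identity; that is the subject of a
  sibling leaf on `U ↦ (fedSol U)⁻¹`, which is `fedMean` by definition), so `IsAnalyticMean fedMean r K` is not
  inhabited HERE and the DERIVATIVE form (0.8″) `‖DM(U)W − mean W‖ ≤ C′‖W‖‖U − 1‖`
  (`IsAnalyticMean.norm_fderiv_sub_mean_le`) has no counterpart here; the integrated use-form (U5) above is proved
  directly instead.  The point of the direct method is the SIZE of the constants: through `IsAnalyticMean fedMean r K`
  with, e.g., `(r, K) = (1/100, 1/32)` the generic forms give Lipschitz `8K/r = 25`, (U4) `64K/r² = 20000`,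
  (47′) `256K/r² = 80000`, (U5) `(2 + 192K/r², 1 + 192K/r²) = (60002, 60001)`, against `11/5, 140, 35, (60, 100)` here.
* small-DIAMETER families far from the identity tuple are treated only at matrix level for UNITARY families (relative
  coordinates need `X ↦ U₀ X U₀⁻¹` to preserve the norm), in `BlockAveragingFederbush` §4–§5; the general `Gᶜ`-family
  case of print is not.
* the constants `11/5, 35, 140, 60, 100` and radii `1/100, 1/200, 1/400` are the FILE's, not print's.

Model conventions: `[cite: Balaban1987RG1, (0.k) p.253]` tags sit only on declarations verifying the corresponding
printed property for THIS `M`; everything else is `[folklore]` (Banach-algebra calculus).  Nothing in this file is a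
cited fact; every statement is kernel-checked from the two imported modules and Mathlib.
-/

noncomputable section

open NormedSpace Metric Set
open scoped NNReal

namespace Literature.MathematicalPhysics.QuantumFieldTheory.Balaban1983to89

namespace FederbushMean

open MatrixLog ExpMeanLog B7TransferAnalyticMean
open B7BlockAvgLog (mlog_exp)
open Literature.Analysis.SpecialFunctions

section NearOne

variable {𝔸 : Type*} [NormedRing 𝔸] [NormedAlgebra ℂ 𝔸] [CompleteSpace 𝔸]
variable {ι : Type*} [Fintype ι]

omit [NormedAlgebra ℂ 𝔸] [CompleteSpace 𝔸] in
/-- Sup norm of a tuple dominates each component: `‖U_j − 1‖ ≤ ‖U − 1‖`. [folklore] -/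
theorem norm_apply_sub_one_le (U : ι → 𝔸) (j : ι) : ‖U j - 1‖ ≤ ‖U - 1‖ := by
  have h := norm_le_pi_norm (U - 1) j
  rwa [Pi.sub_apply, Pi.one_apply] at h

omit [NormedAlgebra ℂ 𝔸] [CompleteSpace 𝔸] in
/-- `‖U − 1‖ ≤ δ` ⇒ every `‖U_j − 1‖ ≤ δ`. [folklore] -/
theorem norm_apply_sub_one_le_of_le {U : ι → 𝔸} {δ : ℝ} (hU : ‖U - 1‖ ≤ δ) (j : ι) : ‖U j - 1‖ ≤ δ :=
  (norm_apply_sub_one_le U j).trans hU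

variable [Nonempty ι]

/-! ## 1. Federbush's mean `M(U) = X(U)⁻¹` near the identity tuple -/

/-- **FEDERBUSH'S MEAN near the identity tuple** (print [Balaban1987RG1] p.253 (0.10): `M` is the implicit function
`Σ_j log (U_j M⁻¹) = 0`): `fedMean U := (fedSol U)⁻¹`, where `fedSol U` is the local solution `X` of `Σ_j log (U_j X) = 0`
constructed in `BlockAveragingFederbush` (for `‖U_j − 1‖ ≤ 1/100`; `X = 1` off that polydisc).
[cite: Balaban1987RG1, (0.10) p.253] -/
def fedMean (U : ι → 𝔸) : 𝔸 := Ring.inverse (fedSol U)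

/-- `‖fedSol U − 1‖ ≤ 3/100` unconditionally (it is `1` off the polydisc). [folklore] -/
theorem norm_fedSol_sub_one_le_three (U : ι → 𝔸) : ‖fedSol U - 1‖ ≤ 3 / 100 := by
  by_cases h : ∀ j, ‖U j - 1‖ ≤ 1 / 100
  · exact (fedSol_spec h).1
  · rw [fedSol_of_not h, sub_self, norm_zero]; norm_num

/-- `fedSol U` is a unit. [folklore] -/
theorem fedSol_isUnit (U : ι → 𝔸) : IsUnit (fedSol U) :=
  (isUnit_and_norm_inverse_sub_one_le (norm_fedSol_sub_one_le_three U) (by norm_num)).1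

/-- `M(U) · X(U) = 1`. [folklore] -/
theorem fedMean_mul_fedSol (U : ι → 𝔸) : fedMean U * fedSol U = 1 :=
  Ring.inverse_mul_cancel _ (fedSol_isUnit U)

/-- `X(U) · M(U) = 1`. [folklore] -/
theorem fedSol_mul_fedMean (U : ι → 𝔸) : fedSol U * fedMean U = 1 :=
  Ring.mul_inverse_cancel _ (fedSol_isUnit U)

/-- `M(U)⁻¹ = X(U)`. [folklore] -/
theorem ring_inverse_fedMean (U : ι → 𝔸) : Ring.inverse (fedMean U) = fedSol U :=
  Ring.inverse_inverse (fedSol_isUnit U)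

/-- `M(U)` is a unit. [folklore] -/
theorem isUnit_fedMean (U : ι → 𝔸) : IsUnit (fedMean U) := by
  obtain ⟨u, hu⟩ := fedSol_isUnit U
  rw [fedMean, ← hu, Ring.inverse_unit]
  exact Units.isUnit _

/-- **(0.10) for `fedMean`**: `Σ_j log (U_j · M(U)⁻¹) = 0` on the polydisc `‖U − 1‖ ≤ 1/100`.
[cite: Balaban1987RG1, (0.10) p.253] -/
theorem sum_mlog_mul_inverse_fedMean {U : ι → 𝔸} (hU : ‖U - 1‖ ≤ 1 / 100) :
    ∑ j, mlog (U j * Ring.inverse (fedMean U)) = 0 := by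
  rw [ring_inverse_fedMean]
  exact sum_mlog_mul_fedSol (norm_apply_sub_one_le_of_le hU)

/-- `M(1, …, 1) = 1`. [folklore] -/
theorem fedMean_one : fedMean (1 : ι → 𝔸) = 1 := by
  rw [fedMean, show (1 : ι → 𝔸) = fun _ => (1 : 𝔸) from rfl, fedSol_const_one, Ring.inverse_one]

/-- `‖M(U) − 1‖ ≤ (31/10)·δ` for `‖U − 1‖ ≤ δ ≤ 1/100`. [folklore] -/
theorem norm_fedMean_sub_one_le {δ : ℝ} (hδ : δ ≤ 1 / 100) {U : ι → 𝔸} (hU : ‖U - 1‖ ≤ δ) :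
    ‖fedMean U - 1‖ ≤ 31 / 10 * δ := by
  have hδ0 : 0 ≤ δ := (norm_nonneg _).trans hU
  have hX := norm_fedSol_sub_one_le hδ (norm_apply_sub_one_le_of_le hU)
  have h := (isUnit_and_norm_inverse_sub_one_le hX (by linarith)).2
  refine h.trans ?_
  rw [div_le_iff₀ (by linarith)]
  nlinarith

omit [NormedAlgebra ℂ 𝔸] [Nonempty ι] [CompleteSpace 𝔸] in
/-- `‖(1 + A) D (1 + B)‖ ≤ (1 + ‖A‖) ‖D‖ (1 + ‖B‖)` (no `‖1‖ = 1` needed). [folklore] -/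
theorem norm_one_add_mul_mul_one_add_le (A D B : 𝔸) :
    ‖(1 + A) * D * (1 + B)‖ ≤ (1 + ‖A‖) * ‖D‖ * (1 + ‖B‖) := by
  have h : (1 + A) * D * (1 + B) = D + A * D + D * B + A * D * B := by noncomm_ring
  rw [h]
  have h1 : ‖A * D‖ ≤ ‖A‖ * ‖D‖ := norm_mul_le _ _
  have h2 : ‖D * B‖ ≤ ‖D‖ * ‖B‖ := norm_mul_le _ _
  have h3 : ‖A * D * B‖ ≤ ‖A‖ * ‖D‖ * ‖B‖ := (norm_mul_le _ _).trans (by gcongr)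
  have := norm_add_le (D + A * D + D * B) (A * D * B)
  have := norm_add_le (D + A * D) (D * B)
  have := norm_add_le D (A * D)
  nlinarith [norm_nonneg A, norm_nonneg B, norm_nonneg D]

/-- **LOCAL UNIQUENESS**: a unit-free characterisation — any `M` with `‖M⁻¹ − 1‖ ≤ 2/25`… stated on the inverse:
if `‖Y − 1‖ ≤ 2/25` and `Σ_j log (U_j Y) = 0` then `Y = M(U)⁻¹ = fedSol U`. [cite: Balaban1987RG1, (0.10) p.253] -/
theorem eq_fedSol_of_sum_mlog_eq_zero {U : ι → 𝔸} (hU : ‖U - 1‖ ≤ 1 / 100) {Y : 𝔸} (hY : ‖Y - 1‖ ≤ 2 / 25)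
    (hsol : ∑ j, mlog (U j * Y) = 0) : Y = fedSol U :=
  fedSol_unique (norm_apply_sub_one_le_of_le hU) hY (by rw [fed_def, hsol, smul_zero])

/-- `log M(U) = − log X(U)`. [folklore] -/
theorem mlog_fedMean (U : ι → 𝔸) : mlog (fedMean U) = -mlog (fedSol U) :=
  mlog_eq_neg_of_mul_eq_one (fedSol_mul_fedMean U) ((norm_fedSol_sub_one_le_three U).trans (by norm_num))

omit [Nonempty ι] [CompleteSpace 𝔸] in
/-- The linearisation of `U ↦ log M(U)` at the identity tuple is the arithmetic mean: `meanCLM` applied to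
`(log U_j)_j` is `fed U 1 = |ι|⁻¹ Σ_j log U_j`. [folklore] -/
theorem meanCLM_mlog_eq_fed_one (U : ι → 𝔸) : meanCLM ι 𝔸 (fun j => mlog (U j)) = fed U 1 := by
  simp [meanCLM_apply, fed_def]

/-! ## 1b. The symmetric-function properties (0.5), (0.6), (0.7) of `fedMean` near the identity tuple, and constants -/

/-- **Constant families**: `M(V, …, V) = V` for `‖V − 1‖ ≤ 1/200` (the constant family's solution of (0.10) is `V⁻¹`).
[folklore] -/
theorem fedMean_const {V : 𝔸} (hV : ‖V - 1‖ ≤ 1 / 200) : fedMean (fun _ : ι => V) = V := by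
  obtain ⟨hu, hinv⟩ := isUnit_and_norm_inverse_sub_one_le hV (by norm_num)
  have hsol : fedSol (fun _ : ι => V) = Ring.inverse V := by
    symm
    refine fedSol_unique (fun _ => hV.trans (by norm_num)) (hinv.trans (by norm_num)) ?_
    rw [fed_def]
    simp [Ring.mul_inverse_cancel _ hu]
  rw [fedMean, hsol, Ring.inverse_inverse hu]

/-- **(0.7)**: `M(U ∘ σ) = M(U)` for every permutation `σ` of the index set (`‖U − 1‖ ≤ 1/100`).
[cite: Balaban1987RG1, (0.7) p.253] -/
theorem fedMean_comp_equiv {U : ι → 𝔸} (hU : ‖U - 1‖ ≤ 1 / 100) (σ : Equiv.Perm ι) :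
    fedMean (U ∘ σ) = fedMean U := by
  rw [fedMean, fedMean, fedSol_comp_equiv (norm_apply_sub_one_le_of_le hU) σ]

omit [NormedAlgebra ℂ 𝔸] [CompleteSpace 𝔸] [Nonempty ι] in
/-- `(v X w)⁻¹ = v X⁻¹ w` for `vw = wv = 1` and a unit `X`. [folklore] -/
theorem ring_inverse_conj {v w X : 𝔸} (hvw : v * w = 1) (hwv : w * v = 1) (hX : IsUnit X) :
    Ring.inverse (v * X * w) = v * Ring.inverse X * w := by
  have h1 : v * X * w * (v * Ring.inverse X * w) = 1 := by
    rw [show v * X * w * (v * Ring.inverse X * w) = v * X * (w * v) * Ring.inverse X * w by noncomm_ring, hwv, mul_one,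
      Ring.mul_inverse_cancel_right _ _ hX, hvw]
  have h2 : v * Ring.inverse X * w * (v * X * w) = 1 := by
    rw [show v * Ring.inverse X * w * (v * X * w) = v * Ring.inverse X * (w * v) * X * w by noncomm_ring, hwv, mul_one,
      Ring.inverse_mul_cancel_right _ _ hX, hvw]
  have hu : IsUnit (v * X * w) := isUnit_iff_exists.mpr ⟨_, h1, h2⟩
  calc Ring.inverse (v * X * w) = Ring.inverse (v * X * w) * (v * X * w * (v * Ring.inverse X * w)) := by
        rw [h1, mul_one]
    _ = v * Ring.inverse X * w := by rw [← mul_assoc, Ring.inverse_mul_cancel _ hu, one_mul]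

/-- **(0.6), conjugations**: `M(v U w) = v M(U) w` for `vw = wv = 1` with `X ↦ v X w` preserving `‖· − 1‖` (true for a
unitary `v = w*` in a `C⋆`-norm; the general two-sided `M(u U v) = u M(U) v` of print is the matrix-level
`BlockAveragingFederbush.fedM_conj`). [cite: Balaban1987RG1, (0.6) p.253] -/
theorem fedMean_conj {v w : 𝔸} (hvw : v * w = 1) (hwv : w * v = 1) (hiso : ∀ X : 𝔸, ‖v * X * w - 1‖ = ‖X - 1‖)
    {U : ι → 𝔸} (hU : ‖U - 1‖ ≤ 1 / 100) : fedMean (fun j => v * U j * w) = v * fedMean U * w := by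
  rw [fedMean, fedMean, fedSol_conj hvw hwv hiso (norm_apply_sub_one_le_of_le hU),
    ring_inverse_conj hvw hwv (fedSol_isUnit U)]

/-- **(0.5)**: `M(U⁻¹) = M(U)⁻¹` for the inverse family `j ↦ U_j⁻¹`, `‖U − 1‖ ≤ 1/200`: the solution of (0.10) for
`U⁻¹` is `M(U)` itself, since `log(U_j⁻¹ X⁻¹) = −X log(U_j X) X⁻¹`. [cite: Balaban1987RG1, (0.5) p.253] -/
theorem fedMean_inverse {U : ι → 𝔸} (hU : ‖U - 1‖ ≤ 1 / 200) :
    fedMean (fun j => Ring.inverse (U j)) = Ring.inverse (fedMean U) := by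
  have hUj := norm_apply_sub_one_le_of_le hU
  have hUu : ∀ j, IsUnit (U j) ∧ ‖Ring.inverse (U j) - 1‖ ≤ (1 / 200) / (1 - 1 / 200) := fun j =>
    isUnit_and_norm_inverse_sub_one_le (hUj j) (by norm_num)
  have hUi : ∀ j, ‖Ring.inverse (U j) - 1‖ ≤ 1 / 100 := fun j => (hUu j).2.trans (by norm_num)
  have hU1 : ∀ j, ‖U j - 1‖ ≤ 1 / 100 := fun j => (hUj j).trans (by norm_num)
  have hlog : ∀ j, mlog (Ring.inverse (U j) * fedMean U) = -(fedSol U * mlog (U j * fedSol U) * fedMean U) := by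
    intro j
    have hprod : fedSol U * U j * (Ring.inverse (U j) * fedMean U) = 1 := by
      rw [mul_assoc, ← mul_assoc (U j), Ring.mul_inverse_cancel _ (hUu j).1, one_mul, fedSol_mul_fedMean]
    have hsmall : ‖fedSol U * U j - 1‖ ≤ 1 / 3 :=
      (norm_mul_sub_one_le (norm_fedSol_sub_one_le_three U) (hU1 j)).trans (by norm_num)
    rw [mlog_eq_neg_of_mul_eq_one hprod hsmall,
      show fedSol U * U j = fedSol U * (U j * fedSol U) * fedMean U by
        simp only [mul_assoc, fedSol_mul_fedMean, mul_one],
      mlog_conj (fedSol_mul_fedMean U) (fedMean_mul_fedSol U)]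
  have key : fedSol (fun j => Ring.inverse (U j)) = fedMean U := by
    symm
    refine fedSol_unique hUi ((norm_fedMean_sub_one_le (δ := 1 / 200) (by norm_num) hU).trans (by norm_num)) ?_
    rw [fed_def, Finset.sum_congr rfl fun j _ => hlog j, Finset.sum_neg_distrib, ← Finset.sum_mul, ← Finset.mul_sum,
      sum_mlog_mul_fedSol hU1, mul_zero, zero_mul, neg_zero, smul_zero]
  change Ring.inverse (fedSol fun j => Ring.inverse (U j)) = Ring.inverse (fedMean U)
  rw [key]

/-! ## 2. (47′): `log M(U)` against the mean of the logarithms -/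

/-- **(0.8)/(47′) for Federbush's mean, explicit constant**: `‖log M(U) − |ι|⁻¹ Σ_j log U_j‖ ≤ 35 ‖U − 1‖²` on the
polydisc `‖U − 1‖ ≤ 1/100` — the shape of `B7TransferAnalyticMean.IsAnalyticMean.norm_mlog_sub_mean_mlog_le` with
`256 K / r²` replaced by the number `35` for print's own proposal (0.10).  [cite: Balaban1987RG1, (0.8) p.253] -/
theorem norm_mlog_fedMean_sub_mean_mlog_le {U : ι → 𝔸} (hU : ‖U - 1‖ ≤ 1 / 100) :
    ‖mlog (fedMean U) - meanCLM ι 𝔸 (fun j => mlog (U j))‖ ≤ 35 * ‖U - 1‖ ^ 2 := by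
  rw [mlog_fedMean, meanCLM_mlog_eq_fed_one,
    show -mlog (fedSol U) - fed U 1 = -(mlog (fedSol U) + fed U 1) by abel, norm_neg]
  exact norm_mlog_fedSol_add_fed_one_le hU (norm_apply_sub_one_le U)

/-! ## 3. (0.8′)=(U4): `log M(e^{X_1}, …, e^{X_n})` against the arithmetic mean of `X` -/

omit [Nonempty ι] in
/-- `‖(e^{X_j})_j − 1‖ ≤ 2‖X‖` for `‖X‖ ≤ 1`. [folklore] -/
theorem norm_exp_tuple_sub_one_le {X : ι → 𝔸} (hX : ‖X‖ ≤ 1) : ‖(fun j => exp (X j)) - (1 : ι → 𝔸)‖ ≤ 2 * ‖X‖ := by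
  refine (pi_norm_le_iff_of_nonneg (by positivity)).mpr fun j => ?_
  have hXj : ‖X j‖ ≤ ‖X‖ := norm_le_pi_norm X j
  simp only [Pi.sub_apply, Pi.one_apply]
  exact (norm_exp_sub_one_le_two_mul (hXj.trans hX)).trans (by gcongr)

omit [Nonempty ι] in
/-- `log e^{X_j} = X_j` componentwise for `‖X‖ < ln 2`. [folklore] -/
theorem mlog_exp_tuple {X : ι → 𝔸} (hX : ‖X‖ < Real.log 2) : (fun j => mlog (exp (X j))) = X :=
  funext fun j => mlog_exp ((norm_le_pi_norm X j).trans_lt hX)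

/-- **(0.8′)/(U4) for Federbush's mean, explicit constant**: `‖log M(e^{X_1},…,e^{X_n}) − |ι|⁻¹ Σ_j X_j‖ ≤ 140 ‖X‖²`
for `‖X‖ ≤ 1/200` — the shape of `IsAnalyticMean.norm_mlog_exp_sub_mean_le` with `64 K / r²` replaced by `140`;
in particular `log M(e^X) − mean(X)` vanishes to second order at `X = 0` — the FILE's quantitative reading, for
print's own `M` (0.10), of the «+ (higher order terms)» of print (0.8) (print assumes of an average only that «it is
an analytic function having the following properties»). [cite: Balaban1987RG1, (0.8) p.253] -/
theorem norm_mlog_fedMean_exp_sub_mean_le {X : ι → 𝔸} (hX : ‖X‖ ≤ 1 / 200) :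
    ‖mlog (fedMean (fun j => exp (X j))) - meanCLM ι 𝔸 X‖ ≤ 140 * ‖X‖ ^ 2 := by
  have hlog2 : (1 : ℝ) / 200 < Real.log 2 := by have := Real.log_two_gt_d9; linarith
  have hU : ‖(fun j => exp (X j)) - (1 : ι → 𝔸)‖ ≤ 2 * ‖X‖ := norm_exp_tuple_sub_one_le (hX.trans (by norm_num))
  have h := norm_mlog_fedMean_sub_mean_mlog_le (hU.trans (by linarith))
  rw [mlog_exp_tuple (hX.trans_lt hlog2)] at h
  refine h.trans ?_
  have h0 : 0 ≤ ‖(fun j => exp (X j)) - (1 : ι → 𝔸)‖ := norm_nonneg _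
  nlinarith

/-! ## 4. Lipschitz continuity near the identity tuple -/

/-- `M(U′) − M(U) = M(U′) (X(U) − X(U′)) M(U)`. [folklore] -/
theorem fedMean_sub_fedMean (U U' : ι → 𝔸) :
    fedMean U' - fedMean U = fedMean U' * (fedSol U - fedSol U') * fedMean U := by
  rw [mul_sub, sub_mul, mul_assoc (fedMean U') (fedSol U), fedSol_mul_fedMean, mul_one, fedMean_mul_fedSol,
    one_mul]

/-- **LIPSCHITZ bound, explicit constant**: `‖M(U′) − M(U)‖ ≤ (11/5) ‖U′ − U‖` on the polydisc `‖· − 1‖ ≤ 1/100`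
(the shape of `IsAnalyticMean.norm_sub_le_near_one` with `8K/r` replaced by `11/5`). [folklore] -/
theorem norm_fedMean_sub_fedMean_le {U U' : ι → 𝔸} (hU : ‖U - 1‖ ≤ 1 / 100) (hU' : ‖U' - 1‖ ≤ 1 / 100) :
    ‖fedMean U' - fedMean U‖ ≤ 11 / 5 * ‖U' - U‖ := by
  have hXX : ‖fedSol U - fedSol U'‖ ≤ 2 * ‖U - U'‖ :=
    norm_fedSol_sub_fedSol_le (norm_apply_sub_one_le_of_le hU) (norm_apply_sub_one_le_of_le hU')
  rw [norm_sub_rev U U'] at hXX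
  have hM := norm_fedMean_sub_one_le le_rfl hU
  have hM' := norm_fedMean_sub_one_le le_rfl hU'
  have key : fedMean U' * (fedSol U - fedSol U') * fedMean U
      = (1 + (fedMean U' - 1)) * (fedSol U - fedSol U') * (1 + (fedMean U - 1)) := by
    rw [add_sub_cancel, add_sub_cancel]
  rw [fedMean_sub_fedMean, key]
  refine (norm_one_add_mul_mul_one_add_le _ _ _).trans ?_
  calc (1 + ‖fedMean U' - 1‖) * ‖fedSol U - fedSol U'‖ * (1 + ‖fedMean U - 1‖)
      ≤ (1 + 31 / 10 * (1 / 100)) * (2 * ‖U' - U‖) * (1 + 31 / 10 * (1 / 100)) := by gcongr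
    _ ≤ 11 / 5 * ‖U' - U‖ := by nlinarith [norm_nonneg (U' - U)]

/-- The same in `B7TransferAnalyticMean`'s `U + V` shape: `‖M(U + V) − M(U)‖ ≤ (11/5)‖V‖` for `‖U − 1‖ ≤ 1/200`,
`‖V‖ ≤ 1/200`. [folklore] -/
theorem norm_fedMean_add_sub_fedMean_le {U V : ι → 𝔸} (hU : ‖U - 1‖ ≤ 1 / 200) (hV : ‖V‖ ≤ 1 / 200) :
    ‖fedMean (U + V) - fedMean U‖ ≤ 11 / 5 * ‖V‖ := by
  have hU' : ‖U + V - 1‖ ≤ 1 / 100 := by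
    calc ‖U + V - 1‖ = ‖(U - 1) + V‖ := by abel_nf
      _ ≤ ‖U - 1‖ + ‖V‖ := norm_add_le _ _
      _ ≤ 1 / 200 + 1 / 200 := by gcongr
      _ = 1 / 100 := by norm_num
  simpa using norm_fedMean_sub_fedMean_le (hU.trans (by norm_num)) hU'

/-! ## 5. The (U5) use-form: `log M(e^{a_1} Z_1, …, e^{a_n} Z_n) − log M(Z)` against the mean of `a` -/

omit [NormedAlgebra ℂ 𝔸] [Nonempty ι] [CompleteSpace 𝔸] in
/-- The bookkeeping identity behind (U5): `E Z X′ − Z X = a + (X′ − X) + ((E − 1 − a) + (E − 1)(Z X′ − 1) + (Z − 1)(X′ − X))`.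
[folklore] -/
theorem expMul_expansion (E Z X X' a : 𝔸) :
    E * Z * X' - Z * X = a + (X' - X) + ((E - 1 - a) + (E - 1) * (Z * X' - 1) + (Z - 1) * (X' - X)) := by
  noncomm_ring

omit [Nonempty ι] in
/-- The real-number bookkeeping of the (U5) estimate at radii `1/400` (`α = ‖a‖`, `ζ = ‖Z − 1‖`, `δ′` the radius of the
shifted family, `ρ` the radius of the products `U′_j X′`). [folklore] -/
theorem u5_numerics {α ζ δ' ρ : ℝ} (hα0 : 0 ≤ α) (hζ0 : 0 ≤ ζ) (hα1 : α ≤ 1 / 400) (hζ4 : ζ ≤ 1 / 400)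
    (hδ' : δ' = 2 * α * ζ + 2 * α + ζ) (hρ : ρ = δ' * (3 * δ') + δ' + 3 * δ') :
    δ' ≤ 1 / 100 ∧ 0 ≤ δ' ∧ ζ ≤ δ' ∧ ρ < 1 ∧ 0 ≤ ρ ∧ 3 * δ' < 1 ∧
    ρ / (1 - ρ) ≤ 84 / 10 * α + 43 / 10 * ζ ∧
    3 * δ' / (1 - 3 * δ') ≤ 62 / 10 * α + 31 / 10 * ζ ∧
    ζ * (3 * ζ) + ζ + 3 * ζ ≤ ρ ∧
    ζ * (3 * δ') + ζ + 3 * δ' ≤ 61 / 10 * α + 41 / 10 * ζ ∧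
    α ^ 2 + 2 * α * (61 / 10 * α + 41 / 10 * ζ) + ζ * (4 * α * (ζ + 1)) ≤ 14 * α ^ 2 + 13 * α * ζ ∧
    α + 4 * α * (ζ + 1) + (14 * α ^ 2 + 13 * α * ζ) ≤ 51 / 10 * α ∧
    (84 / 10 * α + 43 / 10 * ζ) * (51 / 10 * α) ≤ 43 * α ^ 2 + 22 * α * ζ ∧
    (62 / 10 * α + 31 / 10 * ζ) * (4 * α * (ζ + 1)) ≤ 25 * α ^ 2 + 25 / 2 * α * ζ ∧
    (14 * α ^ 2 + 13 * α * ζ) + (43 * α ^ 2 + 22 * α * ζ) + (25 * α ^ 2 + 25 / 2 * α * ζ)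
      ≤ 60 * α * ζ + 100 * α ^ 2 := by
  have hαζ0 : 0 ≤ α * ζ := mul_nonneg hα0 hζ0
  have hαζ : α * ζ ≤ α * (1 / 400) := mul_le_mul_of_nonneg_left hζ4 hα0
  have hαα : α * α ≤ α * (1 / 400) := mul_le_mul_of_nonneg_left hα1 hα0
  have hζζ : ζ * ζ ≤ ζ * (1 / 400) := mul_le_mul_of_nonneg_left hζ4 hζ0
  have hδ'0 : 0 ≤ δ' := by rw [hδ']; positivity
  have hδ'lin : δ' ≤ 201 / 100 * α + ζ := by nlinarith
  have hδ's : δ' ≤ 1 / 100 := by nlinarith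
  have hζδ' : ζ ≤ δ' := by nlinarith
  have hδ'δ' : δ' * δ' ≤ δ' * (1 / 100) := mul_le_mul_of_nonneg_left hδ's hδ'0
  have hρ0 : 0 ≤ ρ := by rw [hρ]; positivity
  have hρlin : ρ ≤ 81 / 10 * α + 41 / 10 * ζ := by nlinarith
  have hρ1 : ρ ≤ 1 / 30 := by nlinarith
  have hρα : ρ * α ≤ (81 / 10 * α + 41 / 10 * ζ) * α := mul_le_mul_of_nonneg_right hρlin hα0
  have hρζ : ρ * ζ ≤ (81 / 10 * α + 41 / 10 * ζ) * ζ := mul_le_mul_of_nonneg_right hρlin hζ0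
  have hδ'α : δ' * α ≤ (201 / 100 * α + ζ) * α := mul_le_mul_of_nonneg_right hδ'lin hα0
  have hδ'ζ : δ' * ζ ≤ (201 / 100 * α + ζ) * ζ := mul_le_mul_of_nonneg_right hδ'lin hζ0
  have hαζζ : α * ζ * ζ ≤ α * ζ * (1 / 400) := mul_le_mul_of_nonneg_left hζ4 hαζ0
  have hααζ : α * α * ζ ≤ α * α * (1 / 400) := mul_le_mul_of_nonneg_left hζ4 (mul_nonneg hα0 hα0)
  refine ⟨hδ's, hδ'0, hζδ', by linarith, hρ0, by linarith, ?_, ?_, ?_, ?_, ?_, ?_, ?_, ?_, ?_⟩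
  · rw [div_le_iff₀ (by linarith)]
    nlinarith [mul_nonneg hρ0 hα0, mul_nonneg hρ0 hζ0]
  · rw [div_le_iff₀ (by linarith)]
    nlinarith [mul_nonneg hδ'0 hα0, mul_nonneg hδ'0 hζ0]
  · nlinarith
  · nlinarith [mul_nonneg hζ0 hδ'0]
  · nlinarith
  · nlinarith
  · nlinarith
  · nlinarith
  · nlinarith

/-- **THE (U5) USE-FORM for Federbush's mean, explicit constants**: for `‖Z − 1‖ ≤ 1/400` and `‖a‖ ≤ 1/400`,
`‖log M(e^{a_1}Z_1, …, e^{a_n}Z_n) − log M(Z) − |ι|⁻¹ Σ_j a_j‖ ≤ 60 ‖a‖ ‖Z − 1‖ + 100 ‖a‖²` — the shape of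
`IsAnalyticMean.norm_mlog_expMul_sub_mlog_sub_mean_le` with `(2 + 192K/r², 1 + 192K/r²)` replaced by the numbers
`(60, 100)`: to first order in `a`, multiplying the family by `e^{a_j}` shifts `log M` by the arithmetic mean of `a`, with an
error `O(‖a‖ ‖Z − 1‖)`.  Proof: subtract the two (0.10) equations `Σ_j log(e^{a_j} Z_j X′) = 0 = Σ_j log(Z_j X)`
(`X = M(Z)⁻¹`, `X′ = M(e^{a}Z)⁻¹`), linearise each logarithm by the mean-value defect
(`norm_mlog_sub_mlog_sub_le`) and expand `e^{a_j} Z_j X′ − Z_j X` by `expMul_expansion`. [folklore] -/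
theorem norm_mlog_fedMean_expMul_sub_mlog_sub_mean_le {Z a : ι → 𝔸} (hZ : ‖Z - 1‖ ≤ 1 / 400)
    (ha : ‖a‖ ≤ 1 / 400) :
    ‖mlog (fedMean (fun j => exp (a j) * Z j)) - mlog (fedMean Z) - meanCLM ι 𝔸 a‖
      ≤ 60 * ‖a‖ * ‖Z - 1‖ + 100 * ‖a‖ ^ 2 := by
  set α := ‖a‖ with hα_def
  set ζ := ‖Z - 1‖ with hζ_def
  have hα0 : 0 ≤ α := norm_nonneg _
  have hζ0 : 0 ≤ ζ := norm_nonneg _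
  have hα1 : α ≤ 1 / 400 := ha
  have hζ4 : ζ ≤ 1 / 400 := hZ
  obtain ⟨δ', hδ'_def⟩ : ∃ δ' : ℝ, δ' = 2 * α * ζ + 2 * α + ζ := ⟨_, rfl⟩
  obtain ⟨ρ, hρ_def⟩ : ∃ ρ : ℝ, ρ = δ' * (3 * δ') + δ' + 3 * δ' := ⟨_, rfl⟩
  obtain ⟨hδ'1, hδ'0, hζδ', hρlt, hρ0, h3lt, hq1, hq0, hBnum, hZXnum, hRnum, hSnum, hDnum, hD0num, hfin⟩ :=
    u5_numerics hα0 hζ0 hα1 hζ4 hδ'_def hρ_def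
  set U' : ι → 𝔸 := fun j => exp (a j) * Z j with hU'_def
  have haj : ∀ j, ‖a j‖ ≤ α := fun j => norm_le_pi_norm a j
  have haj1 : ∀ j, ‖a j‖ ≤ 1 := fun j => (haj j).trans (hα1.trans (by norm_num))
  have hZj : ∀ j, ‖Z j - 1‖ ≤ ζ := fun j => norm_apply_sub_one_le Z j
  have hE1 : ∀ j, ‖exp (a j) - 1‖ ≤ 2 * α := fun j =>
    (norm_exp_sub_one_le_two_mul (haj1 j)).trans (mul_le_mul_of_nonneg_left (haj j) zero_le_two)
  have hE2 : ∀ j, ‖exp (a j) - 1 - a j‖ ≤ α ^ 2 := fun j => by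
    have h1 := norm_exp_sub_one_sub_self_le (a j)
    have h2 := Real.abs_exp_sub_one_sub_id_le (x := ‖a j‖) (by rw [abs_of_nonneg (norm_nonneg _)]; exact haj1 j)
    exact (h1.trans ((le_abs_self _).trans h2)).trans (pow_le_pow_left₀ (norm_nonneg _) (haj j) 2)
  -- the shifted family `U'_j = e^{a_j} Z_j` lies in the polydisc of radius `δ' ≤ 1/100`
  have hU'j : ∀ j, ‖U' j - 1‖ ≤ δ' := fun j => by
    rw [hδ'_def]; exact norm_mul_sub_one_le (hE1 j) (hZj j)
  have hζ1 : ζ ≤ 1 / 100 := hζ4.trans (by norm_num)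
  have hU'1 : ∀ j, ‖U' j - 1‖ ≤ 1 / 100 := fun j => (hU'j j).trans hδ'1
  have hZ1 : ∀ j, ‖Z j - 1‖ ≤ 1 / 100 := fun j => (hZj j).trans hζ1
  have hX1 : ‖fedSol Z - 1‖ ≤ 3 * ζ := norm_fedSol_sub_one_le hζ1 hZj
  have hX'1 : ‖fedSol U' - 1‖ ≤ 3 * δ' := norm_fedSol_sub_one_le hδ'1 hU'j
  have hX1' : ‖fedSol Z - 1‖ ≤ 3 * δ' := hX1.trans (mul_le_mul_of_nonneg_left hζδ' zero_le_three)
  -- `‖U' − Z‖ ≤ 2α(ζ + 1)` and `‖X′ − X‖ ≤ 4α(ζ + 1)`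
  have hζ10 : 0 ≤ ζ + 1 := by linarith
  have h2pos : 0 ≤ 2 * α * (ζ + 1) := mul_nonneg (mul_nonneg zero_le_two hα0) hζ10
  have hUZ : ‖U' - Z‖ ≤ 2 * α * (ζ + 1) := by
    refine (pi_norm_le_iff_of_nonneg h2pos).mpr fun j => ?_
    rw [Pi.sub_apply, hU'_def]
    dsimp only
    rw [show exp (a j) * Z j - Z j = (exp (a j) - 1) * Z j by noncomm_ring]
    exact (norm_sub_mul_le _ _ (hZj j)).trans (mul_le_mul_of_nonneg_right (hE1 j) hζ10)
  have hXX : ‖fedSol U' - fedSol Z‖ ≤ 4 * α * (ζ + 1) := by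
    have h := norm_fedSol_sub_fedSol_le hU'1 hZ1
    linarith
  -- the two (0.10) equations
  have e1 : ∑ j, mlog (U' j * fedSol U') = 0 := sum_mlog_mul_fedSol hU'1
  have e0 : ∑ j, mlog (Z j * fedSol Z) = 0 := sum_mlog_mul_fedSol hZ1
  -- the defects (opaque abbreviations with their defining equations)
  obtain ⟨R, hR_def⟩ : ∃ R : ι → 𝔸, R = fun j => (exp (a j) - 1 - a j) + (exp (a j) - 1) * (Z j * fedSol U' - 1)
      + (Z j - 1) * (fedSol U' - fedSol Z) := ⟨_, rfl⟩
  obtain ⟨D, hD_def⟩ : ∃ D : ι → 𝔸, D = fun j => mlog (U' j * fedSol U') - mlog (Z j * fedSol Z)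
      - (U' j * fedSol U' - Z j * fedSol Z) := ⟨_, rfl⟩
  obtain ⟨D₀, hD₀_def⟩ : ∃ D₀ : 𝔸, D₀ = mlog (fedSol U') - mlog (fedSol Z) - (fedSol U' - fedSol Z) := ⟨_, rfl⟩
  have hRj_eq : ∀ j, R j = (exp (a j) - 1 - a j) + (exp (a j) - 1) * (Z j * fedSol U' - 1)
      + (Z j - 1) * (fedSol U' - fedSol Z) := fun j => by rw [hR_def]
  have hDj_eq : ∀ j, D j = mlog (U' j * fedSol U') - mlog (Z j * fedSol Z)
      - (U' j * fedSol U' - Z j * fedSol Z) := fun j => by rw [hD_def]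
  -- pointwise: U'_j X' − Z_j X = a_j + (X' − X) + R_j, hence log(U'_j X') − log(Z_j X) = a_j + (X' − X) + (R_j + D_j)
  have hUX : ∀ j, U' j * fedSol U' - Z j * fedSol Z = a j + (fedSol U' - fedSol Z) + R j := fun j => by
    rw [hRj_eq, hU'_def]
    exact expMul_expansion (exp (a j)) (Z j) (fedSol Z) (fedSol U') (a j)
  have hj : ∀ j, mlog (U' j * fedSol U') - mlog (Z j * fedSol Z) = a j + (fedSol U' - fedSol Z) + (R j + D j) :=
    fun j => by rw [hDj_eq, hUX j]; abel
  -- averaged: mean(a) + (X' − X) + avg = 0, avg := |ι|⁻¹ Σ_j (R_j + D_j)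
  set avg : 𝔸 := (Fintype.card ι : ℂ)⁻¹ • ∑ j, (R j + D j) with havg_def
  have h0 : meanCLM ι 𝔸 a + (fedSol U' - fedSol Z) + avg = 0 := by
    have hs : (Fintype.card ι : ℂ)⁻¹ • ∑ j, (mlog (U' j * fedSol U') - mlog (Z j * fedSol Z)) = 0 := by
      rw [Finset.sum_sub_distrib, e1, e0, sub_zero, smul_zero]
    rw [← hs]
    simp only [hj, Finset.sum_add_distrib, smul_add, meanCLM_apply, havg_def, avg_const]
  -- hence the quantity to bound is `avg − D₀`
  have hT : mlog (fedMean U') - mlog (fedMean Z) - meanCLM ι 𝔸 a = avg - D₀ := by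
    rw [mlog_fedMean, mlog_fedMean]
    have hm : meanCLM ι 𝔸 a = -(fedSol U' - fedSol Z) - avg := by
      calc meanCLM ι 𝔸 a = (meanCLM ι 𝔸 a + (fedSol U' - fedSol Z) + avg) - (fedSol U' - fedSol Z) - avg := by abel
        _ = -(fedSol U' - fedSol Z) - avg := by rw [h0]; abel
    have hD0 : mlog (fedSol U') = mlog (fedSol Z) + (fedSol U' - fedSol Z) + D₀ := by rw [hD₀_def]; abel
    rw [hm, hD0]
    abel
  rw [hT]
  -- the estimates
  have hA : ∀ j, ‖U' j * fedSol U' - 1‖ ≤ ρ := fun j => by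
    rw [hρ_def]; exact norm_mul_sub_one_le (hU'j j) hX'1
  have hB : ∀ j, ‖Z j * fedSol Z - 1‖ ≤ ρ := fun j => (norm_mul_sub_one_le (hZj j) hX1).trans hBnum
  have hZX' : ∀ j, ‖Z j * fedSol U' - 1‖ ≤ 61 / 10 * α + 41 / 10 * ζ := fun j =>
    (norm_mul_sub_one_le (hZj j) hX'1).trans hZXnum
  have hα20 : 0 ≤ 2 * α := mul_nonneg zero_le_two hα0
  have hRj : ∀ j, ‖R j‖ ≤ 14 * α ^ 2 + 13 * α * ζ := fun j => by
    have h1 : ‖(exp (a j) - 1) * (Z j * fedSol U' - 1)‖ ≤ 2 * α * (61 / 10 * α + 41 / 10 * ζ) :=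
      (norm_mul_le _ _).trans (mul_le_mul (hE1 j) (hZX' j) (norm_nonneg _) hα20)
    have h2 : ‖(Z j - 1) * (fedSol U' - fedSol Z)‖ ≤ ζ * (4 * α * (ζ + 1)) :=
      (norm_mul_le _ _).trans (mul_le_mul (hZj j) hXX (norm_nonneg _) hζ0)
    rw [hRj_eq]
    exact ((norm_add_le _ _).trans (add_le_add ((norm_add_le _ _).trans (add_le_add (hE2 j) h1)) h2)).trans hRnum
  have hSj : ∀ j, ‖U' j * fedSol U' - Z j * fedSol Z‖ ≤ 51 / 10 * α := fun j => by
    rw [hUX j]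
    exact ((norm_add_le _ _).trans (add_le_add ((norm_add_le _ _).trans (add_le_add (haj j) hXX)) (hRj j))).trans
      hSnum
  have hq1pos : 0 ≤ 84 / 10 * α + 43 / 10 * ζ := by linarith
  have hq0pos : 0 ≤ 62 / 10 * α + 31 / 10 * ζ := by linarith
  have hDj : ∀ j, ‖D j‖ ≤ 43 * α ^ 2 + 22 * α * ζ := fun j => by
    rw [hDj_eq]
    refine (norm_mlog_sub_mlog_sub_le hρlt (hA j) (hB j)).trans ?_
    exact (mul_le_mul hq1 (hSj j) (norm_nonneg _) hq1pos).trans hDnum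
  have hD0 : ‖D₀‖ ≤ 25 * α ^ 2 + 25 / 2 * α * ζ := by
    rw [hD₀_def]
    refine (norm_mlog_sub_mlog_sub_le h3lt hX'1 hX1').trans ?_
    exact (mul_le_mul hq0 hXX (norm_nonneg _) hq0pos).trans hD0num
  have havg : ‖avg‖ ≤ (14 * α ^ 2 + 13 * α * ζ) + (43 * α ^ 2 + 22 * α * ζ) :=
    norm_avg_le fun j => (norm_add_le _ _).trans (add_le_add (hRj j) (hDj j))
  exact (norm_sub_le _ _).trans ((add_le_add havg hD0).trans hfin)

end NearOne

/-! ## 6. Identification with the group average of `BlockAveragingFederbush` on unitary families -/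

section MatrixLink

open scoped Matrix.Norms.L2Operator

variable {n : Type*} [Fintype n] [DecidableEq n]
variable {m : ℕ}

/-- On a unitary family, `M(U) = X(U)*`: the inverse of the unitary solution is its adjoint. [folklore] -/
theorem fedMean_eq_star_fedSol {U : Fin (m + 1) → Matrix n n ℂ} (hU : ∀ j, U j ∈ Matrix.unitaryGroup n ℂ)
    (h1 : ‖U - 1‖ ≤ 1 / 100) : fedMean U = star (fedSol U) := by
  have hXu : fedSol U ∈ Matrix.unitaryGroup n ℂ := fedSol_mem_unitaryGroup hU (norm_apply_sub_one_le_of_le h1)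
  calc fedMean U = fedMean U * (fedSol U * star (fedSol U)) := by
        rw [Unitary.mul_star_self_of_mem hXu, mul_one]
    _ = star (fedSol U) := by rw [← mul_assoc, fedMean_mul_fedSol, one_mul]

/-- **(0.9) for `fedMean`**: on a unitary family within `1/100` of the identity tuple, `M(U)` is unitary.
[cite: Balaban1987RG1, (0.9) p.253] -/
theorem fedMean_mem_unitaryGroup {U : Fin (m + 1) → Matrix n n ℂ} (hU : ∀ j, U j ∈ Matrix.unitaryGroup n ℂ)
    (h1 : ‖U - 1‖ ≤ 1 / 100) : fedMean U ∈ Matrix.unitaryGroup n ℂ := by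
  rw [fedMean_eq_star_fedSol hU h1]
  exact Unitary.star_mem (fedSol_mem_unitaryGroup hU (norm_apply_sub_one_le_of_le h1))

/-- **ONE OBJECT**: on a unitary family within `1/100` of the identity MATRIX (sup over the family) and on the guard
of `BlockAveragingFederbush.fedM`, the group average `fedM δ U` (base point `U₀`, relative coordinates `U_j U₀*`)
IS Federbush's mean `fedMean U` near the identity tuple — both are solutions of (0.10) inside the uniqueness polydisc
(`fedM_unique`). [cite: Balaban1987RG1, (0.10) p.253] -/
theorem fedM_eq_fedMean {δ : ℝ} (hδ : δ ≤ 1 / 100) {U : Fin (m + 1) → Matrix n n ℂ}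
    (hU : ∀ j, U j ∈ Matrix.unitaryGroup n ℂ) (h : ∀ i k, ‖U i * star (U k) - 1‖ < δ)
    (h1 : ‖U - 1‖ ≤ 1 / 100) : fedM δ U = fedMean U := by
  have hUj := norm_apply_sub_one_le_of_le h1
  symm
  refine fedM_unique hU hδ h ?_ ?_
  · have hM1 : ‖fedMean U - 1‖ ≤ 31 / 10 * (1 / 100) := norm_fedMean_sub_one_le le_rfl h1
    have hU0 : ‖star (U 0) - 1‖ ≤ 1 / 100 := by rw [norm_star_sub_one]; exact hUj 0
    exact (norm_mul_sub_one_le hM1 hU0).trans (by norm_num)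
  · rw [fedMean_eq_star_fedSol hU h1, star_star]
    exact sum_mlog_mul_fedSol hUj

/-- The guard from closeness to the identity: `‖U_i − 1‖, ‖U_k − 1‖ ≤ ε` ⇒ `‖U_i U_k* − 1‖ ≤ ε² + 2ε`. [folklore] -/
theorem norm_mul_star_sub_one_le {ε : ℝ} {U : Fin (m + 1) → Matrix n n ℂ} (hε : ∀ j, ‖U j - 1‖ ≤ ε) (i k : Fin (m + 1)) :
    ‖U i * star (U k) - 1‖ ≤ ε * ε + ε + ε := by
  have hk : ‖star (U k) - 1‖ ≤ ε := by rw [norm_star_sub_one]; exact hε k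
  exact norm_mul_sub_one_le (hε i) hk

variable [Nonempty n]

/-- **`federbushU` computes `fedMean`**: for a `U(N)`-family with all `‖U_j − 1‖ ≤ 1/300` the group average of
`BlockAveragingFederbush.federbushU` is Federbush's mean of the matrix tuple. [cite: Balaban1987RG1, (0.10) p.253] -/
theorem federbushU_M_eq_fedMean (U : Fin (m + 1) → Matrix.unitaryGroup n ℂ)
    (hε : ∀ j, ‖(U j : Matrix n n ℂ) - 1‖ ≤ 1 / 300) :
    ((federbushU (n := n)).M U : Matrix n n ℂ) = fedMean (fun j => (U j : Matrix n n ℂ)) := by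
  show fedM (1 / 100) (fun j => (U j : Matrix n n ℂ)) = _
  refine fedM_eq_fedMean le_rfl (fun j => (U j).2) (fun i k => ?_) ?_
  · exact (norm_mul_star_sub_one_le (U := fun j => (U j : Matrix n n ℂ)) hε i k).trans_lt (by norm_num)
  · exact (pi_norm_le_iff_of_nonneg (by norm_num)).mpr fun j => by
      rw [Pi.sub_apply, Pi.one_apply]; exact (hε j).trans (by norm_num)

/-- **`federbushSU` computes `fedMean`**: for an `SU(N)`-family with all `‖U_j − 1‖ ≤ δ_N/3` (`δ_N = deltaFed n =
min(1/100, 1/(3N))`) the group average of `BlockAveragingFederbush.federbushSU` is Federbush's mean of the matrix tuple.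
[cite: Balaban1987RG1, (0.10) p.253] -/
theorem federbushSU_M_eq_fedMean (U : Fin (m + 1) → Matrix.specialUnitaryGroup n ℂ)
    (hε : ∀ j, ‖(U j : Matrix n n ℂ) - 1‖ ≤ deltaFed n / 3) :
    ((federbushSU (n := n)).M U : Matrix n n ℂ) = fedMean (fun j => (U j : Matrix n n ℂ)) := by
  show fedM (deltaFed n) (fun j => (U j : Matrix n n ℂ)) = _
  have hd0 : 0 < deltaFed n := deltaFed_pos
  have hd1 : deltaFed n ≤ 1 / 100 := deltaFed_le
  refine fedM_eq_fedMean hd1 (fun j => (U j).2.1) (fun i k => ?_) ?_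
  · refine (norm_mul_star_sub_one_le (U := fun j => (U j : Matrix n n ℂ)) hε i k).trans_lt ?_
    nlinarith
  · exact (pi_norm_le_iff_of_nonneg (by norm_num)).mpr fun j => by
      rw [Pi.sub_apply, Pi.one_apply]; exact (hε j).trans (by linarith)

end MatrixLink

end FederbushMean

end Literature.MathematicalPhysics.QuantumFieldTheory.Balaban1983to89
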